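import Summits.ABC.ABC.Theses.CongruentialReceptacle
import Summits.ABC.ABC.Theorems.CongruentialReceptacleQuarterWindowGivesCrux
import Summits.ABC.ABC.Theorems.CongruentialReceptacleAssembly
import Literature.NumberTheory.DiophantineGeometry.PastenSubexpTheorem14
import HarnessLib

/-!
# Thin-window rigidity: transport of the logarithmic abc bound along the squaring split

Stub `stub_thinWindowSplit` of the line `Descent` (card `balance-window-descent`) for the crux
stmt-ABC-1723 `BalancedFreySzpiro` (Szpiro `6+ε` for the Frey curves of balanced abc triples).

The line transports the logarithmic abc bound `log c ≤ K' + (1+e) · log rad(abc)` along maps of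
abc triples acting on the balance coordinate `t = a/c`. This file is the transport along the
squaring split `P : (a, b, c) ↦ (A, B, C) = (a(a+2b), b², c²)`:

* `(A, B, C)` is again an abc triple (`split_isABCTriple`: `a(a+2b) + b² = (a+b)² = c²`);
* its balance coordinate is `A/C = a(a+2b)/c² = t(2-t)`, because `a + 2b = 2c - a`;
* its radical is at most `(a+2b) · rad(abc) ≤ 2c · rad(abc)` (`rad_split_le`).

Hence the bound at exponent `δ` on `T`, applied to `(A, B, C)`, reads
`2 log c ≤ K' + (1+δ)(log 2 + log c + log rad(abc))`, i.e.
`log c ≤ (K' + (1+δ) log 2)/(1-δ) + ((1+δ)/(1-δ)) · log rad(abc)`. With `δ = ε/(2+ε)` one has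
`1 - δ = 2/(2+ε)`, `(1+δ)/(1-δ) = 1 + ε` exactly, and for `K' ≥ 0`, `0 < ε ≤ 1` the constant is
`(K' + (1+δ) log 2)(2+ε)/2 ≤ (3/2) K' + 2 log 2 ≤ 2K' + 5` (`Real.log_two_lt_d9`). This generalises
the landed `log_descent_core` (same split triple, same bookkeeping) from window inequalities to an
arbitrary set `T` of balance coordinates.
-/

-- `Summit.<Summit>.<Problem>` is the mandated summit-side namespace (CONVENTIONS §2); for the
-- single-conjunct summit `ABC` the two coincide, so the duplicate `ABC.ABC` is deliberate.
set_option linter.dupNamespace false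

noncomputable section

open Real
open Literature.NumberTheory.DiophantineGeometry
open Summit.ABC.ABC.Theses.CongruentialReceptacle

namespace Summit.ABC.ABC.Theorems

/-- **Transport along the squaring split `(a, b, c) ↦ (a(a+2b), b², c²)`.** If the logarithmic abc
bound `log c ≤ K' + (1+δ) · log rad(abc)` with `δ = ε/(2+ε)`, `K' ≥ 0`, `0 < ε ≤ 1` holds for every
abc triple with balance coordinate `a/c ∈ T`, then `log c ≤ 2K' + 5 + (1+ε) · log rad(abc)` holds
for every abc triple with `(a/c)(2 - a/c) ∈ T`: apply the hypothesis to the split triple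
`(a(a+2b), b², c²)` (`split_isABCTriple`), whose coordinate is `a(a+2b)/c² = (a/c)(2 - a/c)` and
whose radical is `≤ 2c · rad(abc)` (`rad_split_le`), getting
`2 log c ≤ K' + (1+δ)(log 2 + log c + log rad(abc))`; then divide by `1 - δ = 2/(2+ε) > 0` and use
`(1+δ)/(1-δ) = 1+ε`, `(K' + (1+δ) log 2)/(1-δ) ≤ 2K' + 5`. [folklore] -/
theorem stub_thinWindowSplit {T : Set ℝ} {ε δ K' : ℝ} (hε : 0 < ε) (hε1 : ε ≤ 1)
    (hδ : δ = ε / (2 + ε)) (hK' : 0 ≤ K')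
    (H : ∀ a b c : ℕ, IsABCTriple a b c → (a : ℝ) / (c : ℝ) ∈ T →
      Real.log (c : ℝ) ≤ K' + (1 + δ) * Real.log ((rad a b c : ℕ) : ℝ)) :
    ∀ a b c : ℕ, IsABCTriple a b c →
      (a : ℝ) / (c : ℝ) ∈ {t : ℝ | t * (2 - t) ∈ T} →
        Real.log (c : ℝ) ≤ 2 * K' + 5 + (1 + ε) * Real.log ((rad a b c : ℕ) : ℝ) := by
  intro a b c h ht
  simp only [Set.mem_setOf_eq] at ht
  -- constants: `δ = ε/(2+ε)` has `0 < δ ≤ 1/3`, `(1+δ)/(1-δ) = 1 + ε`, and the constant term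
  -- `(K' + (1+δ) log 2)/(1-δ)` is at most `2K' + 5`
  have h2ε : (0 : ℝ) < 2 + ε := by positivity
  have hδ0 : 0 < δ := by
    rw [hδ]
    positivity
  have hδ3 : δ ≤ 1 / 3 := by
    rw [hδ, div_le_iff₀ h2ε]
    linarith
  have h1m : 0 < 1 - δ := by linarith
  have h1p : 0 ≤ 1 + δ := by linarith
  have hlog2 : 0 ≤ Real.log 2 := Real.log_nonneg one_le_two
  have hratio : (1 + δ) / (1 - δ) = 1 + ε := by
    rw [div_eq_iff h1m.ne', hδ]
    field_simp
    ring
  have hconst : (K' + (1 + δ) * Real.log 2) / (1 - δ) ≤ 2 * K' + 5 := by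
    rw [div_le_iff₀ h1m]
    have h13 : 0 ≤ 1 / 3 - δ := by linarith
    nlinarith [mul_nonneg hK' h13, mul_nonneg hlog2 h13, Real.log_two_lt_d9]
  -- the split triple `(a(a+2b), b², c²)`
  obtain ⟨ha0, hb0, habc, hcop⟩ := h
  have hT : IsABCTriple (a * (a + 2 * b)) (b ^ 2) (c ^ 2) :=
    split_isABCTriple ⟨ha0, hb0, habc, hcop⟩
  have hc0' : c ≠ 0 := by omega
  have haR : (0 : ℝ) < a := by exact_mod_cast ha0
  have hbR : (0 : ℝ) < b := by exact_mod_cast hb0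
  have hcR : (c : ℝ) = a + b := by exact_mod_cast habc.symm
  have hcpos : (0 : ℝ) < c := by rw [hcR]; exact add_pos haR hbR
  have hcne : (c : ℝ) ≠ 0 := hcpos.ne'
  -- its balance coordinate is `a(a+2b)/c² = t(2-t)` for `t = a/c`, since `a + 2b = 2c - a`
  have hcoord : ((a * (a + 2 * b) : ℕ) : ℝ) / ((c ^ 2 : ℕ) : ℝ)
      = (a : ℝ) / (c : ℝ) * (2 - (a : ℝ) / (c : ℝ)) := by
    have hbca : (b : ℝ) = c - a := by linarith
    push_cast
    rw [hbca]
    field_simp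
    ring
  have hmem : ((a * (a + 2 * b) : ℕ) : ℝ) / ((c ^ 2 : ℕ) : ℝ) ∈ T := by
    rw [hcoord]
    exact ht
  have hmain := H _ _ _ hT hmem
  -- radicals: `rad(a(a+2b) b² c²) ≤ (a+2b) · rad(abc) ≤ 2c · rad(abc)`
  have hr0 : 0 < rad a b c := Nat.radical_pos _
  have hrpos : (0 : ℝ) < ((rad a b c : ℕ) : ℝ) := by exact_mod_cast hr0
  have hrS0 : 0 < rad (a * (a + 2 * b)) (b ^ 2) (c ^ 2) := Nat.radical_pos _
  have hrSpos : (0 : ℝ) < ((rad (a * (a + 2 * b)) (b ^ 2) (c ^ 2) : ℕ) : ℝ) := by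
    exact_mod_cast hrS0
  have hradle : ((rad (a * (a + 2 * b)) (b ^ 2) (c ^ 2) : ℕ) : ℝ)
      ≤ 2 * c * ((rad a b c : ℕ) : ℝ) := by
    have h1 : rad (a * (a + 2 * b)) (b ^ 2) (c ^ 2) ≤ (a + 2 * b) * rad a b c :=
      rad_split_le ha0.ne' hb0.ne' hc0'
    have h2 : ((rad (a * (a + 2 * b)) (b ^ 2) (c ^ 2) : ℕ) : ℝ)
        ≤ ((a + 2 * b : ℕ) : ℝ) * ((rad a b c : ℕ) : ℝ) := by exact_mod_cast h1
    have h3 : ((a + 2 * b : ℕ) : ℝ) ≤ 2 * c := by push_cast; linarith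
    exact h2.trans (mul_le_mul_of_nonneg_right h3 hrpos.le)
  have hlogS : Real.log ((rad (a * (a + 2 * b)) (b ^ 2) (c ^ 2) : ℕ) : ℝ)
      ≤ Real.log 2 + Real.log c + Real.log ((rad a b c : ℕ) : ℝ) := by
    have h := Real.log_le_log hrSpos hradle
    rwa [Real.log_mul (by positivity) hrpos.ne', Real.log_mul (by norm_num) hcpos.ne'] at h
  have hlogc2 : Real.log ((c ^ 2 : ℕ) : ℝ) = 2 * Real.log c := by
    push_cast
    rw [Real.log_pow]
    norm_num
  rw [hlogc2] at hmain
  -- `2 log c ≤ K' + (1+δ)(log 2 + log c + log rad)`, i.e.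
  -- `log c ≤ (K' + (1+δ) log 2)/(1-δ) + ((1+δ)/(1-δ)) · log rad`
  have hkey := mul_le_mul_of_nonneg_left hlogS h1p
  have hcore : Real.log (c : ℝ)
      ≤ (K' + (1 + δ) * Real.log 2) / (1 - δ)
        + (1 + δ) / (1 - δ) * Real.log ((rad a b c : ℕ) : ℝ) := by
    rw [div_mul_eq_mul_div, ← add_div, le_div_iff₀ h1m]
    linarith
  -- slope `(1+δ)/(1-δ) = 1 + ε`, constant `≤ 2K' + 5`
  rw [hratio] at hcore
  linarith

end Summit.ABC.ABC.Theorems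

end
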